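import Mathlib.Analysis.SpecialFunctions.Complex.LogBounds
import Mathlib.Analysis.SpecialFunctions.Complex.Arg
import Mathlib.Analysis.Complex.ExponentialBounds
import Mathlib.Analysis.Real.Pi.Bounds
import Mathlib.Algebra.Polynomial.BigOperators
import HarnessLib

/-!
# Barvinok's disc-to-strip polynomial (Barvinok 2016, Lemma 2.2.3)

Topic `Literature/Analysis/Complex` (namespace `Literature.Analysis.Complex.DiscToStrip`).
Everything in this file is PROVED (no named facts).

Barvinok's interpolation lemma (Lemma 2.2.1 of the book; `BarvinokInterpolation.lean`) needs a
polynomial without zeros in a disc `‖z‖ ≤ β`, `β > 1`. To use it for a polynomial that is merely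
zero-free on a neighbourhood of the segment `[0, 1]`, Barvinok composes with an explicit
polynomial `φ = φ_ρ` with `φ(0) = 0`, `φ(1) = 1` mapping the disc `‖z‖ ≤ β(ρ)` (`β(ρ) > 1`) into
the thin rectangle `-ρ ≤ Re z ≤ 1 + 2ρ`, `|Im z| ≤ 2ρ` around `[0, 1]`. For `0 < ρ < 1`:

* `α = α(ρ) = 1 - e^{-1/ρ}`, `β = β(ρ) = (1 - e^{-1-1/ρ}) / (1 - e^{-1/ρ}) > 1`,
  `N = N(ρ) = ⌊(1 + 1/ρ) e^{1 + 1/ρ}⌋ ≥ 14`, `σ = σ(ρ) = ∑_{m=1}^{N} α^m / m`,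
* `φ_ρ(z) = σ⁻¹ ∑_{m=1}^{N} (α z)^m / m` (`phi ρ`, a polynomial of degree `≤ N`);

**Lemma 2.2.3** (`phi_eval_mem_strip`, with `one_lt_beta`, `phi_eval_zero`, `phi_eval_one`,
`natDegree_phi_le`; packaged as `exists_polynomial_disc_to_strip`): `φ(0) = 0`, `φ(1) = 1` and
`-ρ ≤ Re φ(z) ≤ 1 + 2ρ`, `|Im φ(z)| ≤ 2ρ` whenever `‖z‖ ≤ β`.

Proof (Barvinok, *Approximating permanents and hafnians*, Lemma 8.1, followed literally). With
`F(w) = -ρ Log(1 - w)` on `‖w‖ < 1`: `|Im F| ≤ πρ/2` and `Re F ≥ -ρ ln 2` (8.1.1); `F(α) = 1` and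
`Re F(w) ≤ 1 + ρ` for `‖w‖ ≤ 1 - e^{-1-1/ρ} = αβ` (8.1.2); the Taylor tail gives
`|F(αz) - ρ P_N(αz)| ≤ ρ (αβ)^{N+1}/((N+1)(1 - αβ)) ≤ ρ/(N+1) ≤ ρ/15` for `‖z‖ ≤ β`, where
`P_N(w) = ∑_{m=1}^N w^m/m` (8.1.3; Mathlib's `Complex.norm_log_sub_logTaylor_le` and
`(1-y)^{N+1} ≤ e^{-(N+1)y} ≤ y` for `y = e^{-1-1/ρ}`, `N + 1 ≥ (1 + 1/ρ)e^{1+1/ρ}`); hence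
`|Im ρP_N(αz)| ≤ (π/2 + 1/15)ρ`, `-(ln 2 + 1/15)ρ ≤ Re ρP_N(αz) ≤ 1 + ρ + ρ/15` (8.1.4) and
`|1 - ρσ| ≤ ρ/15` (8.1.5); dividing by `ρσ ≥ 1 - ρ/15` gives the claim (with `π < 3.15`,
`ln 2 < 0.6932`).

## References
* [Barvinok2016] A. Barvinok, *Combinatorics and Complexity of Partition Functions*, Springer
  2016, Lemma 2.2.3 (paywalled; statement and proof taken from the restatements below).
* [BarvinokDA2017] A. Barvinok, Approximating permanents and hafnians, *Discrete Analysis* 2017:2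
  (arXiv:1601.07518), Lemma 8.1 with proof. READ (p. 16 of the arXiv version).
* [PatelRegts2017] V. Patel, G. Regts, *SIAM J. Comput.* 46 (2017), Lemma 4.3 (restates the
  lemma). READ (arXiv:1607.01167 §4.1).
-/

noncomputable section

open Polynomial Finset

namespace Literature.Analysis.Complex

open _root_.Complex

namespace DiscToStrip

/-! ### The data `α, β, N, σ, φ` -/

/-- `α(ρ) = 1 - e^{-1/ρ}`. [cite: BarvinokDA2017, Lemma 8.1] -/
def alpha (ρ : ℝ) : ℝ := 1 - Real.exp (-ρ⁻¹)

/-- `β(ρ) = (1 - e^{-1-1/ρ}) / (1 - e^{-1/ρ})`, the radius of the disc (`> 1`).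
[cite: BarvinokDA2017, Lemma 8.1] -/
def beta (ρ : ℝ) : ℝ := (1 - Real.exp (-1 - ρ⁻¹)) / (1 - Real.exp (-ρ⁻¹))

/-- `N(ρ) = ⌊(1 + 1/ρ) e^{1 + 1/ρ}⌋`, the degree of `φ_ρ`. [cite: BarvinokDA2017, Lemma 8.1] -/
def degree (ρ : ℝ) : ℕ := ⌊(1 + ρ⁻¹) * Real.exp (1 + ρ⁻¹)⌋₊

/-- The truncated logarithmic series `P_n(w) = ∑_{m=1}^{n} w^m / m` (so `P_n → -Log(1 - w)`).
[cite: BarvinokDA2017, proof of Lemma 8.1] -/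
def truncLog (n : ℕ) (w : ℂ) : ℂ := ∑ m ∈ range n, w ^ (m + 1) / (m + 1)

/-- `σ(ρ) = ∑_{m=1}^{N} α^m / m = P_N(α)`. [cite: BarvinokDA2017, Lemma 8.1] -/
def sigma (ρ : ℝ) : ℝ := ∑ m ∈ range (degree ρ), alpha ρ ^ (m + 1) / (m + 1)

/-- **Barvinok's disc-to-strip polynomial** `φ_ρ(z) = σ⁻¹ ∑_{m=1}^{N} (α z)^m / m`.
[cite: BarvinokDA2017, Lemma 8.1] -/
def phi (ρ : ℝ) : ℂ[X] :=
  C ((sigma ρ : ℂ)⁻¹) * ∑ m ∈ range (degree ρ), C ((alpha ρ : ℂ) ^ (m + 1) / (m + 1)) * X ^ (m + 1)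

/-! ### Elementary facts about the constants -/

section Constants

variable {ρ : ℝ}

/-- `e^{-1/ρ} < 1` for `ρ > 0`. [folklore] -/
theorem exp_neg_inv_lt_one (hρ : 0 < ρ) : Real.exp (-ρ⁻¹) < 1 :=
  Real.exp_lt_one_iff.2 (by have := inv_pos.2 hρ; linarith)

/-- `e^{-1-1/ρ} < e^{-1/ρ}`. [folklore] -/
theorem exp_neg_one_sub_inv_lt (ρ : ℝ) : Real.exp (-1 - ρ⁻¹) < Real.exp (-ρ⁻¹) :=
  Real.exp_lt_exp.2 (by linarith)

/-- `0 < α(ρ)` for `ρ > 0`. [cite: BarvinokDA2017, Lemma 8.1] -/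
theorem alpha_pos (hρ : 0 < ρ) : 0 < alpha ρ := sub_pos.2 (exp_neg_inv_lt_one hρ)

/-- `α(ρ) < 1`. [cite: BarvinokDA2017, Lemma 8.1] -/
theorem alpha_lt_one (ρ : ℝ) : alpha ρ < 1 := sub_lt_self _ (Real.exp_pos _)

/-- `β(ρ) > 1` for `ρ > 0`. [cite: BarvinokDA2017, Lemma 8.1] -/
theorem one_lt_beta (hρ : 0 < ρ) : 1 < beta ρ := by
  have h : (0 : ℝ) < 1 - Real.exp (-ρ⁻¹) := alpha_pos hρ
  rw [beta, one_lt_div h]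
  linarith [exp_neg_one_sub_inv_lt ρ]

/-- `α β = 1 - e^{-1-1/ρ}`. [cite: BarvinokDA2017, proof of Lemma 8.1] -/
theorem alpha_mul_beta (hρ : 0 < ρ) : alpha ρ * beta ρ = 1 - Real.exp (-1 - ρ⁻¹) := by
  have hα : alpha ρ ≠ 0 := (alpha_pos hρ).ne'
  unfold beta
  rw [← mul_div_assoc, show (1 : ℝ) - Real.exp (-ρ⁻¹) = alpha ρ from rfl, mul_div_cancel_left₀ _ hα]

/-- `(1 + 1/ρ) e^{1+1/ρ} < N + 1`. [folklore] -/
theorem lt_degree_add_one (ρ : ℝ) : (1 + ρ⁻¹) * Real.exp (1 + ρ⁻¹) < (degree ρ : ℝ) + 1 :=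
  Nat.lt_floor_add_one _

/-- `N(ρ) ≥ 1` for `ρ > 0`. [folklore] -/
theorem one_le_degree (hρ : 0 < ρ) : 1 ≤ degree ρ := by
  refine Nat.le_floor ?_
  have h1 : (1 : ℝ) ≤ 1 + ρ⁻¹ := by have := inv_pos.2 hρ; linarith
  have h2 : (1 : ℝ) ≤ Real.exp (1 + ρ⁻¹) := Real.one_le_exp (by linarith)
  simpa using mul_le_mul h1 h2 zero_le_one (by linarith)

/-- `N(ρ) ≥ 14` for `0 < ρ < 1` (Barvinok: `(1 + 1/ρ)e^{1+1/ρ} > 2e² > 14`).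
[cite: BarvinokDA2017, Lemma 8.1] -/
theorem fourteen_le_degree (hρ0 : 0 < ρ) (hρ1 : ρ < 1) : 14 ≤ degree ρ := by
  have hK : 2 < 1 + ρ⁻¹ := by have := (one_lt_inv₀ hρ0).2 hρ1; linarith
  have he : 7 < Real.exp (1 + ρ⁻¹) := by
    have h1 := Real.exp_one_gt_d9
    have h2 : Real.exp 2 < Real.exp (1 + ρ⁻¹) := Real.exp_lt_exp.2 hK
    have h3 : Real.exp 2 = Real.exp 1 * Real.exp 1 := by rw [← Real.exp_add]; norm_num
    nlinarith
  have h := lt_degree_add_one ρ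
  have h14 : (14 : ℝ) < degree ρ + 1 := by nlinarith
  have h13 : (13 : ℝ) < degree ρ := by linarith
  have h13' : 13 < degree ρ := by exact_mod_cast h13
  omega

/-- `σ(ρ) > 0` for `ρ > 0`. [folklore] -/
theorem sigma_pos (hρ : 0 < ρ) : 0 < sigma ρ := by
  unfold sigma
  refine Finset.sum_pos (fun m _ => ?_) ?_
  · have := alpha_pos hρ
    positivity
  · exact Finset.nonempty_range_iff.2 (by have := one_le_degree hρ; omega)

/-- The key decay estimate `(1 - y)^{N+1} ≤ y` for `y = e^{-1-1/ρ}` (from `1 - y ≤ e^{-y}` and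
`(N+1) y ≥ (1 + 1/ρ)`). [cite: BarvinokDA2017, proof of Lemma 8.1, (8.1.3)] -/
theorem one_sub_exp_pow_le (hρ : 0 < ρ) :
    (1 - Real.exp (-1 - ρ⁻¹)) ^ (degree ρ + 1) ≤ Real.exp (-1 - ρ⁻¹) := by
  set y := Real.exp (-1 - ρ⁻¹) with hy
  set K := 1 + ρ⁻¹ with hK
  have hyK : y = Real.exp (-K) := by rw [hy, hK]; congr 1; ring
  have hy0 : 0 < y := Real.exp_pos _
  have hy1 : y < 1 := Real.exp_lt_one_iff.2 (by have := inv_pos.2 hρ; linarith)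
  have h1 : 1 - y ≤ Real.exp (-y) := by linarith [Real.add_one_le_exp (-y)]
  have h2 : (1 - y) ^ (degree ρ + 1) ≤ Real.exp (-y) ^ (degree ρ + 1) :=
    pow_le_pow_left₀ (by linarith) h1 _
  have hKN : K * Real.exp K < degree ρ + 1 := lt_degree_add_one ρ
  have hyexp : Real.exp K * y = 1 := by rw [hyK, ← Real.exp_add]; simp
  have h4 : K ≤ (degree ρ + 1) * y :=
    calc K = K * (Real.exp K * y) := by rw [hyexp, mul_one]
      _ = K * Real.exp K * y := by ring
      _ ≤ (degree ρ + 1) * y := mul_le_mul_of_nonneg_right hKN.le hy0.le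
  calc (1 - y) ^ (degree ρ + 1) ≤ Real.exp (-y) ^ (degree ρ + 1) := h2
    _ = Real.exp ((degree ρ + 1 : ℕ) * (-y)) := (Real.exp_nat_mul _ _).symm
    _ ≤ Real.exp (-K) := Real.exp_le_exp.2 (by push_cast; rw [mul_neg]; exact neg_le_neg h4)
    _ = y := hyK.symm

end Constants

/-! ### The polynomial `φ` and its values -/

/-- `φ(z) = σ⁻¹ P_N(α z)`. [cite: BarvinokDA2017, Lemma 8.1] -/
theorem phi_eval (ρ : ℝ) (z : ℂ) :
    (phi ρ).eval z = (sigma ρ : ℂ)⁻¹ * truncLog (degree ρ) (alpha ρ * z) := by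
  rw [phi, eval_mul, eval_C, eval_finsetSum, truncLog]
  congr 1
  refine Finset.sum_congr rfl fun m _ => ?_
  rw [eval_mul, eval_C, eval_pow, eval_X, mul_pow]
  ring

/-- `φ(0) = 0`. [cite: BarvinokDA2017, Lemma 8.1] -/
theorem phi_eval_zero (ρ : ℝ) : (phi ρ).eval 0 = 0 := by
  simp [phi_eval, truncLog]

/-- `P_N(α) = σ` (as a complex number). [folklore] -/
theorem truncLog_alpha (ρ : ℝ) : truncLog (degree ρ) (alpha ρ : ℂ) = (sigma ρ : ℂ) := by
  rw [truncLog, sigma]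
  push_cast
  rfl

/-- `φ(1) = 1` (for `ρ > 0`, so that `σ > 0`). [cite: BarvinokDA2017, Lemma 8.1] -/
theorem phi_eval_one {ρ : ℝ} (hρ : 0 < ρ) : (phi ρ).eval 1 = 1 := by
  have hσ : (sigma ρ : ℂ) ≠ 0 := ofReal_ne_zero.2 (sigma_pos hρ).ne'
  rw [phi_eval, mul_one, truncLog_alpha, inv_mul_cancel₀ hσ]

/-- `deg φ ≤ N`. [cite: BarvinokDA2017, Lemma 8.1] -/
theorem natDegree_phi_le (ρ : ℝ) : (phi ρ).natDegree ≤ degree ρ := by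
  refine (natDegree_C_mul_le _ _).trans (natDegree_sum_le_of_forall_le _ _ fun m hm => ?_)
  have hm' : m < degree ρ := Finset.mem_range.1 hm
  exact (natDegree_C_mul_X_pow_le _ _).trans (by omega)

/-! ### The logarithm `Log(1 - w)` on the unit disc -/

/-- `(-1)^{n+1} (-w)^n = -w^n`. [folklore] -/
theorem neg_one_pow_succ_mul_neg_pow (w : ℂ) (n : ℕ) : (-1 : ℂ) ^ (n + 1) * (-w) ^ n = -w ^ n := by
  rw [pow_succ', mul_assoc, ← mul_pow]
  simp

/-- Mathlib's `logTaylor (n+1)` at `-w` is `-P_n(w)`. [folklore] -/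
theorem logTaylor_succ_neg_eq (n : ℕ) (w : ℂ) : logTaylor (n + 1) (-w) = -truncLog n w := by
  rw [truncLog, logTaylor, Finset.sum_range_succ', ← Finset.sum_neg_distrib]
  simp only [pow_zero, Nat.cast_zero, div_zero, add_zero]
  refine Finset.sum_congr rfl fun k _ => ?_
  rw [neg_one_pow_succ_mul_neg_pow, neg_div]
  push_cast
  ring

/-- The Taylor tail `|Log(1 - w) + P_n(w)| ≤ |w|^{n+1}/((n+1)(1 - |w|))` for `|w| < 1`.
[cite: BarvinokDA2017, proof of Lemma 8.1] -/
theorem norm_log_one_sub_add_truncLog_le {w : ℂ} (hw : ‖w‖ < 1) (n : ℕ) :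
    ‖log (1 - w) + truncLog n w‖ ≤ ‖w‖ ^ (n + 1) * (1 - ‖w‖)⁻¹ / (n + 1) := by
  have h1 : ‖-w‖ < 1 := by rwa [norm_neg]
  have h := norm_log_sub_logTaylor_le n h1
  rw [logTaylor_succ_neg_eq, sub_neg_eq_add, norm_neg, ← sub_eq_add_neg] at h
  exact h

/-- `Re (1 - w) > 0` for `|w| < 1`. [folklore] -/
theorem one_sub_re_pos {w : ℂ} (hw : ‖w‖ < 1) : 0 < (1 - w).re := by
  have h := (abs_le.1 (abs_re_le_norm w)).2
  rw [sub_re, one_re]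
  linarith

/-- (8.1.1), imaginary part: `|Im Log(1 - w)| < π/2` for `|w| < 1`.
[cite: BarvinokDA2017, proof of Lemma 8.1, (8.1.1)] -/
theorem abs_log_one_sub_im_lt {w : ℂ} (hw : ‖w‖ < 1) : |(log (1 - w)).im| < Real.pi / 2 := by
  rw [log_im]
  exact abs_arg_lt_pi_div_two_iff.2 (Or.inl (one_sub_re_pos hw))

/-- (8.1.1), real part: `Re Log(1 - w) < ln 2` for `|w| < 1`.
[cite: BarvinokDA2017, proof of Lemma 8.1, (8.1.1)] -/
theorem log_one_sub_re_lt {w : ℂ} (hw : ‖w‖ < 1) : (log (1 - w)).re < Real.log 2 := by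
  rw [log_re]
  have h1 : ‖1 - w‖ < 2 := by
    calc ‖1 - w‖ ≤ ‖(1 : ℂ)‖ + ‖w‖ := norm_sub_le _ _
      _ < 2 := by rw [norm_one]; linarith
  have h0 : 0 < ‖1 - w‖ := by
    refine norm_pos_iff.2 fun h => ?_
    have := one_sub_re_pos hw
    rw [h] at this
    simp at this
  exact Real.log_lt_log h0 h1

/-- (8.1.2), real part: `ln (1 - |w|) ≤ Re Log(1 - w)` for `|w| < 1`.
[cite: BarvinokDA2017, proof of Lemma 8.1, (8.1.2)] -/
theorem log_one_sub_norm_le_re {w : ℂ} (hw : ‖w‖ < 1) :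
    Real.log (1 - ‖w‖) ≤ (log (1 - w)).re := by
  rw [log_re]
  have h : 1 - ‖w‖ ≤ ‖1 - w‖ := by
    have := norm_sub_norm_le (1 : ℂ) w
    rwa [norm_one] at this
  exact Real.log_le_log (by linarith) h

/-! ### Two elementary division estimates -/

/-- `u ≤ B`, `0 ≤ B`, `0 < D₁ ≤ D` give `u/D ≤ B/D₁`. [folklore] -/
theorem div_le_div_of_le_of_le {u B D D₁ : ℝ} (hu : u ≤ B) (hB : 0 ≤ B) (hD : D₁ ≤ D)
    (hD₁ : 0 < D₁) : u / D ≤ B / D₁ :=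
  (div_le_div_of_nonneg_right hu (hD₁.le.trans hD)).trans (div_le_div_of_nonneg_left hB hD₁ hD)

/-- `-A ≤ u`, `0 ≤ A`, `0 < D₁ ≤ D` give `-(A/D₁) ≤ u/D`. [folklore] -/
theorem neg_div_le_div_of_le_of_le {u A D D₁ : ℝ} (hu : -A ≤ u) (hA : 0 ≤ A) (hD : D₁ ≤ D)
    (hD₁ : 0 < D₁) : -(A / D₁) ≤ u / D := by
  have h1 : -A / D ≤ u / D := div_le_div_of_nonneg_right hu (hD₁.le.trans hD)
  have h2 : A / D ≤ A / D₁ := div_le_div_of_nonneg_left hA hD₁ hD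
  rw [neg_div] at h1
  linarith

/-! ### Lemma 2.2.3 -/

/-- **Barvinok's disc-to-strip lemma** (Barvinok 2016, Lemma 2.2.3 = Barvinok DA 2017, Lemma 8.1 =
Patel–Regts 2017, Lemma 4.3 (ii)): for `0 < ρ < 1` and `‖z‖ ≤ β(ρ)`,
`-ρ ≤ Re φ_ρ(z) ≤ 1 + 2ρ` and `|Im φ_ρ(z)| ≤ 2ρ`. [cite: Barvinok2016, Lemma 2.2.3] -/
theorem phi_eval_mem_strip {ρ : ℝ} (hρ0 : 0 < ρ) (hρ1 : ρ < 1) {z : ℂ} (hz : ‖z‖ ≤ beta ρ) :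
    -ρ ≤ ((phi ρ).eval z).re ∧ ((phi ρ).eval z).re ≤ 1 + 2 * ρ ∧
      |((phi ρ).eval z).im| ≤ 2 * ρ := by
  -- the constants
  have ha0 : 0 < alpha ρ := alpha_pos hρ0
  have ha1 : alpha ρ < 1 := alpha_lt_one ρ
  have hy0 : 0 < Real.exp (-1 - ρ⁻¹) := Real.exp_pos _
  have hy1 : Real.exp (-1 - ρ⁻¹) < 1 :=
    Real.exp_lt_one_iff.2 (by have := inv_pos.2 hρ0; linarith)
  have hab : alpha ρ * beta ρ = 1 - Real.exp (-1 - ρ⁻¹) := alpha_mul_beta hρ0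
  have hβ1 : 1 < beta ρ := one_lt_beta hρ0
  have hN15 : (15 : ℝ) ≤ (degree ρ : ℝ) + 1 := by
    have := fourteen_le_degree hρ0 hρ1
    have h' : (14 : ℝ) ≤ degree ρ := by exact_mod_cast this
    linarith
  have hpow := one_sub_exp_pow_le hρ0
  have hρc : (ρ : ℂ) ≠ 0 := ofReal_ne_zero.2 hρ0.ne'
  have hlog2 := Real.log_two_lt_d9
  have hpi := Real.pi_lt_d2
  -- (8.1.3): the Taylor tail is at most `1/15` on the disc `‖w‖ ≤ αβ = 1 - y`
  have htail : ∀ w : ℂ, ‖w‖ ≤ 1 - Real.exp (-1 - ρ⁻¹) →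
      ‖log (1 - w) + truncLog (degree ρ) w‖ ≤ 1 / 15 := by
    intro w hw
    have hw1 : ‖w‖ < 1 := by linarith
    refine (norm_log_one_sub_add_truncLog_le hw1 (degree ρ)).trans ?_
    have h1 : ‖w‖ ^ (degree ρ + 1) ≤ (1 - Real.exp (-1 - ρ⁻¹)) ^ (degree ρ + 1) :=
      pow_le_pow_left₀ (norm_nonneg _) hw _
    have h2 : (1 - ‖w‖)⁻¹ ≤ (Real.exp (-1 - ρ⁻¹))⁻¹ := inv_anti₀ hy0 (by linarith)
    have h3 : ‖w‖ ^ (degree ρ + 1) * (1 - ‖w‖)⁻¹ ≤ 1 :=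
      calc ‖w‖ ^ (degree ρ + 1) * (1 - ‖w‖)⁻¹
          ≤ (1 - Real.exp (-1 - ρ⁻¹)) ^ (degree ρ + 1) * (Real.exp (-1 - ρ⁻¹))⁻¹ :=
            mul_le_mul h1 h2 (inv_nonneg.2 (by linarith)) (pow_nonneg (by linarith) _)
        _ ≤ Real.exp (-1 - ρ⁻¹) * (Real.exp (-1 - ρ⁻¹))⁻¹ :=
            mul_le_mul_of_nonneg_right hpow (inv_nonneg.2 hy0.le)
        _ = 1 := mul_inv_cancel₀ hy0.ne'
    calc ‖w‖ ^ (degree ρ + 1) * (1 - ‖w‖)⁻¹ / (degree ρ + 1) ≤ 1 / (degree ρ + 1) :=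
          div_le_div_of_nonneg_right h3 (by positivity)
      _ ≤ 1 / 15 := div_le_div_of_nonneg_left zero_le_one (by norm_num) hN15
  -- the point `w = α z` of the disc
  have hwn : ‖(alpha ρ : ℂ) * z‖ ≤ 1 - Real.exp (-1 - ρ⁻¹) := by
    rw [norm_mul, norm_real, Real.norm_eq_abs, abs_of_pos ha0, ← hab]
    exact mul_le_mul_of_nonneg_left hz ha0.le
  have hw1 : ‖(alpha ρ : ℂ) * z‖ < 1 := by linarith
  -- (8.1.1)–(8.1.3) at `w`
  have hE := htail _ hwn
  have hEre := (abs_le.1 ((abs_re_le_norm _).trans hE))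
  have hEim := (abs_le.1 ((abs_im_le_norm _).trans hE))
  have hLim := abs_lt.1 (abs_log_one_sub_im_lt hw1)
  have hLre1 : (log (1 - alpha ρ * z)).re < Real.log 2 := log_one_sub_re_lt hw1
  have hLre2 : -(1 + ρ⁻¹) ≤ (log (1 - alpha ρ * z)).re := by
    have h := log_one_sub_norm_le_re hw1
    have h' : Real.log (Real.exp (-1 - ρ⁻¹)) ≤ Real.log (1 - ‖(alpha ρ : ℂ) * z‖) :=
      Real.log_le_log hy0 (by linarith)
    rw [Real.log_exp] at h'
    linarith
  -- (8.1.4): real and imaginary parts of `ρ P_N(α z)`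
  have hPre : (truncLog (degree ρ) (alpha ρ * z)).re
      = (log (1 - alpha ρ * z) + truncLog (degree ρ) (alpha ρ * z)).re
        - (log (1 - alpha ρ * z)).re := by
    rw [add_re]; ring
  have hPim : (truncLog (degree ρ) (alpha ρ * z)).im
      = (log (1 - alpha ρ * z) + truncLog (degree ρ) (alpha ρ * z)).im
        - (log (1 - alpha ρ * z)).im := by
    rw [add_im]; ring
  have hu_lo : -((1 / 15 + Real.log 2) * ρ) ≤ ((ρ : ℂ) * truncLog (degree ρ) (alpha ρ * z)).re := by
    rw [re_ofReal_mul, hPre]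
    nlinarith [hEre.1, hLre1]
  have hu_hi : ((ρ : ℂ) * truncLog (degree ρ) (alpha ρ * z)).re ≤ ρ / 15 + ρ + 1 := by
    rw [re_ofReal_mul, hPre]
    have : ρ * ((log (1 - ↑(alpha ρ) * z) + truncLog (degree ρ) (↑(alpha ρ) * z)).re
        - (log (1 - ↑(alpha ρ) * z)).re) ≤ ρ * (1 / 15 + (1 + ρ⁻¹)) :=
      mul_le_mul_of_nonneg_left (by linarith [hEre.2]) hρ0.le
    have h1 : ρ * ρ⁻¹ = 1 := mul_inv_cancel₀ hρ0.ne'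
    nlinarith
  have hv : |((ρ : ℂ) * truncLog (degree ρ) (alpha ρ * z)).im| ≤ (1 / 15 + Real.pi / 2) * ρ := by
    rw [im_ofReal_mul, hPim, abs_mul, abs_of_pos hρ0, mul_comm]
    refine mul_le_mul_of_nonneg_right (abs_le.2 ⟨?_, ?_⟩) hρ0.le
    · linarith [hEim.1, hLim.2]
    · linarith [hEim.2, hLim.1]
  -- (8.1.5): at `z = 1`, `|ρ σ - 1| ≤ ρ/15`
  have hσ : |sigma ρ - ρ⁻¹| ≤ 1 / 15 := by
    have hαn : ‖(alpha ρ : ℂ)‖ ≤ 1 - Real.exp (-1 - ρ⁻¹) := by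
      rw [norm_real, Real.norm_eq_abs, abs_of_pos ha0, ← hab]
      exact le_mul_of_one_le_right ha0.le hβ1.le
    have h := htail _ hαn
    have hlog : log (1 - (alpha ρ : ℂ)) = ((-ρ⁻¹ : ℝ) : ℂ) := by
      have e : (1 : ℂ) - alpha ρ = ((Real.exp (-ρ⁻¹) : ℝ) : ℂ) := by
        rw [alpha]; push_cast; ring
      rw [e, ← ofReal_log (Real.exp_pos _).le, Real.log_exp]
    rw [hlog, truncLog_alpha, ← ofReal_add, norm_real, Real.norm_eq_abs] at h
    rwa [show -ρ⁻¹ + sigma ρ = sigma ρ - ρ⁻¹ by ring] at h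
  have hD_lo : 1 - ρ / 15 ≤ ρ * sigma ρ := by
    have h := mul_le_mul_of_nonneg_left (abs_le.1 hσ).1 hρ0.le
    rw [mul_sub, mul_inv_cancel₀ hρ0.ne'] at h
    linarith
  have hD0 : 0 < 1 - ρ / 15 := by linarith
  -- `φ(z) = ρ P_N(αz) / (ρ σ)`
  have hφ : (phi ρ).eval z
      = ((ρ : ℂ) * truncLog (degree ρ) (alpha ρ * z)) / ((ρ * sigma ρ : ℝ) : ℂ) := by
    rw [phi_eval, ofReal_mul, mul_div_mul_left _ _ hρc, div_eq_inv_mul]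
  rw [hφ, div_ofReal_re, div_ofReal_im]
  refine ⟨?_, ?_, ?_⟩
  · -- lower bound for the real part
    have hA : 0 ≤ (1 / 15 + Real.log 2) * ρ := by
      have := Real.log_pos one_lt_two
      positivity
    refine le_trans ?_ (neg_div_le_div_of_le_of_le hu_lo hA hD_lo hD0)
    rw [neg_le_neg_iff, div_le_iff₀ hD0]
    nlinarith
  · -- upper bound for the real part
    refine (div_le_div_of_le_of_le hu_hi (by positivity) hD_lo hD0).trans ?_
    rw [div_le_iff₀ hD0]
    nlinarith
  · -- the imaginary part
    rw [abs_div, abs_of_pos (hD0.trans_le hD_lo)]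
    refine (div_le_div_of_le_of_le hv (by positivity) hD_lo hD0).trans ?_
    rw [div_le_iff₀ hD0]
    nlinarith

/-- **Barvinok 2016, Lemma 2.2.3** packaged: for every `0 < ρ < 1` there are `β > 1` and a
complex polynomial `φ` with `φ(0) = 0`, `φ(1) = 1` that maps the closed disc `‖z‖ ≤ β` into the
rectangle `-ρ ≤ Re z ≤ 1 + 2ρ`, `|Im z| ≤ 2ρ` (namely `β = beta ρ`, `φ = phi ρ`, of degree
`≤ degree ρ`). [cite: Barvinok2016, Lemma 2.2.3] -/
theorem exists_polynomial_disc_to_strip {ρ : ℝ} (hρ0 : 0 < ρ) (hρ1 : ρ < 1) :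
    ∃ (β : ℝ) (φ : ℂ[X]), 1 < β ∧ φ.eval 0 = 0 ∧ φ.eval 1 = 1 ∧
      ∀ z : ℂ, ‖z‖ ≤ β →
        -ρ ≤ (φ.eval z).re ∧ (φ.eval z).re ≤ 1 + 2 * ρ ∧ |(φ.eval z).im| ≤ 2 * ρ :=
  ⟨beta ρ, phi ρ, one_lt_beta hρ0, phi_eval_zero ρ, phi_eval_one hρ0,
    fun _ hz => phi_eval_mem_strip hρ0 hρ1 hz⟩

end DiscToStrip

end Literature.Analysis.Complex
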